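import Literature.NumberTheory.Rogawski1990.ArchCentralLimitFunctionalSymmetryEightRay   -- ★ p842285 (N7-bis): the 8-ray `Λ` tokens, `lambda8_iteratedDeriv_const_mul`
import HarnessLib

/-!
# The letter's 8-ray functional `Λ_x[·]` as an ENGINE functional: LOCALITY on the regular set, HOMOGENEITY, FINITE ADDITIVITY at smooth points — the three rules the
# two-sided descent ★ `descent_two_sided_prod_mul_eq` (★ p842302) and the one-step limit (N5 §2a) consume (Rogawski 1990 §8.4 pp. 126–127)

Topic `NumberTheory/Rogawski1990`; namespace `Literature.NumberTheory.Rogawski1990`.  THEOREMS ONLY (no `def`, no instance, no notation, no axiom, no named fact, no `sorry`);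
torus-side calculus only.  Cell `pub/hodgecm-mathlib`, ENGINE T1 (crux H413 = `stmt-HodgeConjecture-24833`); ROAD-Sd residual R4, SdArch ED. 3 node N5 (F0P3a-p03 (g11)'s census
`CENSUS-N5-ArchCentralDescentRankTwo` 783c9612: §2a «`Λ_v` is linear over this finite sum at REGULAR `v`», §2b; and the abstract engine's `hΛcongr`∕`hΛmul`); author F0P3a-p06 (g11).

THE FUNCTIONAL (the letter ★ p842205's tokens, `ρ′Δ` inside): for `Φ : (Fin 3 → Circle) → ℂ` and `x : Fin 3 → Circle`,
`Λ_x[Φ] := (1∕48)·Σ_{ε : Fin 3 → Bool} (s₀s₁s₂)·iteratedDeriv 3 (fun s => ρ′Δ(r_ε s)·Φ(r_ε s)) 0`, `r_ε s = fun k => x k * Circle.exp (s * V_ε k)`, `V_ε = ![s₀+s₁, −s₀+s₂, −s₁−s₂]`,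
`ρ′Δ(r) = ↑r₀(↑r₂)⁻¹·((1−↑r₁(↑r₀)⁻¹)(1−↑r₂(↑r₁)⁻¹)(1−↑r₂(↑r₀)⁻¹))` — spelled INLINE.

WHAT IS PROVED.
* `isOpen_setOf_injective_fin_circle` — the regular set `{x : Fin 3 → Circle | Injective x}` is open; `eventually_ray_mem_of_isOpen` — a ray from a point of an open set stays inside for small `s`.
* **`lambda8_rhoWeylDelta_congr_of_eqOn`** — LOCALITY: `Φ = Ψ` on the regular set ⇒ `Λ_x[Φ] = Λ_x[Ψ]` at every regular `x` (Mathlib `Filter.EventuallyEq.iteratedDeriv_eq` along each ray) —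
  the engine's `hΛcongr`; in particular `Λ_x[Φ] = 0` at regular `x` when `Φ` vanishes on the regular set (census §2b).
* **`lambda8_rhoWeylDelta_const_mul`** — HOMOGENEITY: `Λ_x[c·Φ] = c·Λ_x[Φ]` (every `x`, no smoothness) — the engine's `hΛmul`.
* **`lambda8_rhoWeylDelta_finset_sum`** — FINITE ADDITIVITY at a point where every ray function `s ↦ ρ′Δ(r_ε s)·Φ_i(r_ε s)` is `C³` at `s = 0` (Mathlib `iteratedDeriv_fun_sum`) — census §2a's
  «linear over this finite sum at REGULAR `v`» (the `C³` input is ★ (A1) `contDiffOn_integral_comp_conj_circleDiagonal_angles_of_blocks` for orbital `Φ_i`), and its limit form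
  `tendsto_lambda8_rhoWeylDelta_finset_sum` (termwise limits ⇒ limit of the sum, additivity holding eventually along `𝓝[regular] centre`).
HONEST LABEL: HC_CM is proved only modulo the printed citations until rung 0 closes; this file is bookkeeping for R4's assembly and pays nothing by itself.

## References
* [Rogawski1990] J. D. Rogawski, *Automorphic Representations of Unitary Groups in Three Variables*, Ann. of Math. Stud. 123 (1990), §8.4 pp. 126–127.
-/

set_option autoImplicit false

noncomputable section

open Filter Topology Complex Set

namespace Literature.NumberTheory.Rogawski1990

/-! ## §1 The regular set is open; rays stay regular for small time -/

section Regular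

/-- **The regular set of the circle torus is open**: `{x : Fin 3 → S¹ | x injective} = ⋂_{i ≠ j} {x | x i ≠ x j}`. [cite: Rogawski1990, §8.4 p. 126] -/
theorem isOpen_setOf_injective_fin_circle : IsOpen {x : Fin 3 → Circle | Function.Injective x} := by
  have h : {x : Fin 3 → Circle | Function.Injective x} = ⋂ i : Fin 3, ⋂ j : Fin 3, {x : Fin 3 → Circle | i ≠ j → x i ≠ x j} := by
    ext x
    simp only [Set.mem_setOf_eq, Set.mem_iInter]
    constructor
    · intro hx i j hij hxij
      exact hij (hx hxij)
    · intro h i j hxij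
      by_contra hij
      exact h i j hij hxij
  rw [h]
  refine isOpen_iInter_of_finite fun i => isOpen_iInter_of_finite fun j => ?_
  by_cases hij : i = j
  · have : {x : Fin 3 → Circle | i ≠ j → x i ≠ x j} = Set.univ := by
      ext x; simp [hij]
    rw [this]; exact isOpen_univ
  · have : {x : Fin 3 → Circle | i ≠ j → x i ≠ x j} = {x : Fin 3 → Circle | x i ≠ x j} := by
      ext x; simp [hij]
    rw [this]
    exact isOpen_ne_fun (continuous_apply i) (continuous_apply j)

/-- **A circle ray from a point of an open set stays in it for small time**: `s ↦ (x_k e^{isu_k})_k` is continuous with value `x` at `s = 0`. [cite: Rogawski1990, §8.4 p. 126] -/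
theorem eventually_ray_mem_of_isOpen {U : Set (Fin 3 → Circle)} (hU : IsOpen U) {x : Fin 3 → Circle} (hx : x ∈ U) (u : Fin 3 → ℝ) :
    ∀ᶠ s : ℝ in 𝓝 0, (fun k => x k * Circle.exp (s * u k)) ∈ U := by
  have hc : Continuous fun s : ℝ => (fun k => x k * Circle.exp (s * u k)) :=
    continuous_pi fun k => continuous_const.mul (Circle.exp.continuous.comp (continuous_id.mul continuous_const))
  have h0 : (fun k => x k * Circle.exp ((0 : ℝ) * u k)) = x := by
    funext k; simp
  have ht := hc.tendsto (0 : ℝ)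
  rw [h0] at ht
  exact ht (hU.mem_nhds hx)

end Regular

/-! ## §2 Locality, homogeneity, finite additivity of `Λ_x[·]` -/

section Engine

/-- **LOCALITY of the letter's functional on the regular set**: if `Φ = Ψ` on `{x | Injective x}` then `Λ_x[Φ] = Λ_x[Ψ]` at every regular `x` — each of the 8 ray functions of `Φ` and `Ψ`
agree near `s = 0` (the ray stays regular), so their third derivatives at `0` agree (Mathlib `Filter.EventuallyEq.iteratedDeriv_eq`).  This is the `hΛcongr` rule of ★ `descent_two_sided_prod_mul_eq`.
[cite: Rogawski1990, §8.4 p. 126] -/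
theorem lambda8_rhoWeylDelta_congr_of_eqOn {Φ Ψ : (Fin 3 → Circle) → ℂ} (h : EqOn Φ Ψ {x : Fin 3 → Circle | Function.Injective x}) :
    EqOn (fun x : Fin 3 → Circle =>
        (1 / 48 : ℂ) * ∑ ε : Fin 3 → Bool, (((if ε 0 then (1 : ℝ) else -1) * (if ε 1 then (1 : ℝ) else -1) * (if ε 2 then (1 : ℝ) else -1) : ℝ) : ℂ) *
          iteratedDeriv 3 (fun s : ℝ => (fun z' : Fin 3 → Circle =>
              ((z' 0 : ℂ) * ((z' 2 : ℂ))⁻¹ * ((1 - (z' 1 : ℂ) * ((z' 0 : ℂ))⁻¹) * (1 - (z' 2 : ℂ) * ((z' 1 : ℂ))⁻¹) * (1 - (z' 2 : ℂ) * ((z' 0 : ℂ))⁻¹))) * Φ z')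
            (fun k => x k * Circle.exp (s * ![(if ε 0 then (1 : ℝ) else -1) + (if ε 1 then (1 : ℝ) else -1), -(if ε 0 then (1 : ℝ) else -1) + (if ε 2 then (1 : ℝ) else -1),
              -(if ε 1 then (1 : ℝ) else -1) - (if ε 2 then (1 : ℝ) else -1)] k))) 0)
      (fun x : Fin 3 → Circle =>
        (1 / 48 : ℂ) * ∑ ε : Fin 3 → Bool, (((if ε 0 then (1 : ℝ) else -1) * (if ε 1 then (1 : ℝ) else -1) * (if ε 2 then (1 : ℝ) else -1) : ℝ) : ℂ) *
          iteratedDeriv 3 (fun s : ℝ => (fun z' : Fin 3 → Circle =>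
              ((z' 0 : ℂ) * ((z' 2 : ℂ))⁻¹ * ((1 - (z' 1 : ℂ) * ((z' 0 : ℂ))⁻¹) * (1 - (z' 2 : ℂ) * ((z' 1 : ℂ))⁻¹) * (1 - (z' 2 : ℂ) * ((z' 0 : ℂ))⁻¹))) * Ψ z')
            (fun k => x k * Circle.exp (s * ![(if ε 0 then (1 : ℝ) else -1) + (if ε 1 then (1 : ℝ) else -1), -(if ε 0 then (1 : ℝ) else -1) + (if ε 2 then (1 : ℝ) else -1),
              -(if ε 1 then (1 : ℝ) else -1) - (if ε 2 then (1 : ℝ) else -1)] k))) 0)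
      {x : Fin 3 → Circle | Function.Injective x} := by
  intro x hx
  have hε : ∀ ε : Fin 3 → Bool,
      iteratedDeriv 3 (fun s : ℝ => (fun z' : Fin 3 → Circle =>
          ((z' 0 : ℂ) * ((z' 2 : ℂ))⁻¹ * ((1 - (z' 1 : ℂ) * ((z' 0 : ℂ))⁻¹) * (1 - (z' 2 : ℂ) * ((z' 1 : ℂ))⁻¹) * (1 - (z' 2 : ℂ) * ((z' 0 : ℂ))⁻¹))) * Φ z')
          (fun k => x k * Circle.exp (s * ![(if ε 0 then (1 : ℝ) else -1) + (if ε 1 then (1 : ℝ) else -1), -(if ε 0 then (1 : ℝ) else -1) + (if ε 2 then (1 : ℝ) else -1),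
            -(if ε 1 then (1 : ℝ) else -1) - (if ε 2 then (1 : ℝ) else -1)] k))) 0 =
        iteratedDeriv 3 (fun s : ℝ => (fun z' : Fin 3 → Circle =>
          ((z' 0 : ℂ) * ((z' 2 : ℂ))⁻¹ * ((1 - (z' 1 : ℂ) * ((z' 0 : ℂ))⁻¹) * (1 - (z' 2 : ℂ) * ((z' 1 : ℂ))⁻¹) * (1 - (z' 2 : ℂ) * ((z' 0 : ℂ))⁻¹))) * Ψ z')
          (fun k => x k * Circle.exp (s * ![(if ε 0 then (1 : ℝ) else -1) + (if ε 1 then (1 : ℝ) else -1), -(if ε 0 then (1 : ℝ) else -1) + (if ε 2 then (1 : ℝ) else -1),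
            -(if ε 1 then (1 : ℝ) else -1) - (if ε 2 then (1 : ℝ) else -1)] k))) 0 := by
    intro ε
    refine Filter.EventuallyEq.iteratedDeriv_eq 3 ?_
    filter_upwards [eventually_ray_mem_of_isOpen isOpen_setOf_injective_fin_circle hx
      ![(if ε 0 then (1 : ℝ) else -1) + (if ε 1 then (1 : ℝ) else -1), -(if ε 0 then (1 : ℝ) else -1) + (if ε 2 then (1 : ℝ) else -1),
        -(if ε 1 then (1 : ℝ) else -1) - (if ε 2 then (1 : ℝ) else -1)]] with s hs
    rw [h hs]
  exact congrArg (fun t : ℂ => (1 / 48 : ℂ) * t) (Finset.sum_congr rfl fun ε _ => by rw [hε ε])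

/-- **HOMOGENEITY**: `Λ_x[c·Φ] = c·Λ_x[Φ]` at every `x` (no smoothness; ★ `lambda8_iteratedDeriv_const_mul`) — the `hΛmul` rule of ★ `descent_two_sided_prod_mul_eq`. [cite: Rogawski1990, §8.4 p. 126] -/
theorem lambda8_rhoWeylDelta_const_mul (c : ℂ) (Φ : (Fin 3 → Circle) → ℂ) (x : Fin 3 → Circle) :
    (1 / 48 : ℂ) * ∑ ε : Fin 3 → Bool, (((if ε 0 then (1 : ℝ) else -1) * (if ε 1 then (1 : ℝ) else -1) * (if ε 2 then (1 : ℝ) else -1) : ℝ) : ℂ) *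
          iteratedDeriv 3 (fun s : ℝ => (fun z' : Fin 3 → Circle =>
              ((z' 0 : ℂ) * ((z' 2 : ℂ))⁻¹ * ((1 - (z' 1 : ℂ) * ((z' 0 : ℂ))⁻¹) * (1 - (z' 2 : ℂ) * ((z' 1 : ℂ))⁻¹) * (1 - (z' 2 : ℂ) * ((z' 0 : ℂ))⁻¹))) * (c * Φ z'))
            (fun k => x k * Circle.exp (s * ![(if ε 0 then (1 : ℝ) else -1) + (if ε 1 then (1 : ℝ) else -1), -(if ε 0 then (1 : ℝ) else -1) + (if ε 2 then (1 : ℝ) else -1),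
              -(if ε 1 then (1 : ℝ) else -1) - (if ε 2 then (1 : ℝ) else -1)] k))) 0 =
      c * ((1 / 48 : ℂ) * ∑ ε : Fin 3 → Bool, (((if ε 0 then (1 : ℝ) else -1) * (if ε 1 then (1 : ℝ) else -1) * (if ε 2 then (1 : ℝ) else -1) : ℝ) : ℂ) *
          iteratedDeriv 3 (fun s : ℝ => (fun z' : Fin 3 → Circle =>
              ((z' 0 : ℂ) * ((z' 2 : ℂ))⁻¹ * ((1 - (z' 1 : ℂ) * ((z' 0 : ℂ))⁻¹) * (1 - (z' 2 : ℂ) * ((z' 1 : ℂ))⁻¹) * (1 - (z' 2 : ℂ) * ((z' 0 : ℂ))⁻¹))) * Φ z')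
            (fun k => x k * Circle.exp (s * ![(if ε 0 then (1 : ℝ) else -1) + (if ε 1 then (1 : ℝ) else -1), -(if ε 0 then (1 : ℝ) else -1) + (if ε 2 then (1 : ℝ) else -1),
              -(if ε 1 then (1 : ℝ) else -1) - (if ε 2 then (1 : ℝ) else -1)] k))) 0) := by
  have hfun : (fun z' : Fin 3 → Circle =>
      ((z' 0 : ℂ) * ((z' 2 : ℂ))⁻¹ * ((1 - (z' 1 : ℂ) * ((z' 0 : ℂ))⁻¹) * (1 - (z' 2 : ℂ) * ((z' 1 : ℂ))⁻¹) * (1 - (z' 2 : ℂ) * ((z' 0 : ℂ))⁻¹))) * (c * Φ z')) =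
      fun z' : Fin 3 → Circle => c * ((fun w : Fin 3 → Circle =>
        ((w 0 : ℂ) * ((w 2 : ℂ))⁻¹ * ((1 - (w 1 : ℂ) * ((w 0 : ℂ))⁻¹) * (1 - (w 2 : ℂ) * ((w 1 : ℂ))⁻¹) * (1 - (w 2 : ℂ) * ((w 0 : ℂ))⁻¹))) * Φ w) z') := by
    funext z'; simp only []; ring
  rw [hfun]
  exact lambda8_iteratedDeriv_const_mul c (fun w : Fin 3 → Circle =>
    ((w 0 : ℂ) * ((w 2 : ℂ))⁻¹ * ((1 - (w 1 : ℂ) * ((w 0 : ℂ))⁻¹) * (1 - (w 2 : ℂ) * ((w 1 : ℂ))⁻¹) * (1 - (w 2 : ℂ) * ((w 0 : ℂ))⁻¹))) * Φ w) x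

/-- **FINITE ADDITIVITY at a smooth point**: if every ray function `s ↦ ρ′Δ(r_ε s)·Φ_i(r_ε s)` is `C³` at `s = 0` (e.g. `x` regular and `Φ_i` a torus orbital integral, ★ (A1)), then
`Λ_x[Σ_{i∈I} Φ_i] = Σ_{i∈I} Λ_x[Φ_i]` (Mathlib `iteratedDeriv_fun_sum`). [cite: Rogawski1990, §8.4 p. 126] -/
theorem lambda8_rhoWeylDelta_finset_sum {ι : Type*} (I : Finset ι) (Φ : ι → (Fin 3 → Circle) → ℂ) (x : Fin 3 → Circle)
    (hΦ : ∀ i ∈ I, ∀ ε : Fin 3 → Bool, ContDiffAt ℝ 3 (fun s : ℝ => (fun z' : Fin 3 → Circle =>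
        ((z' 0 : ℂ) * ((z' 2 : ℂ))⁻¹ * ((1 - (z' 1 : ℂ) * ((z' 0 : ℂ))⁻¹) * (1 - (z' 2 : ℂ) * ((z' 1 : ℂ))⁻¹) * (1 - (z' 2 : ℂ) * ((z' 0 : ℂ))⁻¹))) * Φ i z')
        (fun k => x k * Circle.exp (s * ![(if ε 0 then (1 : ℝ) else -1) + (if ε 1 then (1 : ℝ) else -1), -(if ε 0 then (1 : ℝ) else -1) + (if ε 2 then (1 : ℝ) else -1),
          -(if ε 1 then (1 : ℝ) else -1) - (if ε 2 then (1 : ℝ) else -1)] k))) 0) :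
    (1 / 48 : ℂ) * ∑ ε : Fin 3 → Bool, (((if ε 0 then (1 : ℝ) else -1) * (if ε 1 then (1 : ℝ) else -1) * (if ε 2 then (1 : ℝ) else -1) : ℝ) : ℂ) *
          iteratedDeriv 3 (fun s : ℝ => (fun z' : Fin 3 → Circle =>
              ((z' 0 : ℂ) * ((z' 2 : ℂ))⁻¹ * ((1 - (z' 1 : ℂ) * ((z' 0 : ℂ))⁻¹) * (1 - (z' 2 : ℂ) * ((z' 1 : ℂ))⁻¹) * (1 - (z' 2 : ℂ) * ((z' 0 : ℂ))⁻¹))) * (∑ i ∈ I, Φ i z'))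
            (fun k => x k * Circle.exp (s * ![(if ε 0 then (1 : ℝ) else -1) + (if ε 1 then (1 : ℝ) else -1), -(if ε 0 then (1 : ℝ) else -1) + (if ε 2 then (1 : ℝ) else -1),
              -(if ε 1 then (1 : ℝ) else -1) - (if ε 2 then (1 : ℝ) else -1)] k))) 0 =
      ∑ i ∈ I, (1 / 48 : ℂ) * ∑ ε : Fin 3 → Bool, (((if ε 0 then (1 : ℝ) else -1) * (if ε 1 then (1 : ℝ) else -1) * (if ε 2 then (1 : ℝ) else -1) : ℝ) : ℂ) *
          iteratedDeriv 3 (fun s : ℝ => (fun z' : Fin 3 → Circle =>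
              ((z' 0 : ℂ) * ((z' 2 : ℂ))⁻¹ * ((1 - (z' 1 : ℂ) * ((z' 0 : ℂ))⁻¹) * (1 - (z' 2 : ℂ) * ((z' 1 : ℂ))⁻¹) * (1 - (z' 2 : ℂ) * ((z' 0 : ℂ))⁻¹))) * Φ i z')
            (fun k => x k * Circle.exp (s * ![(if ε 0 then (1 : ℝ) else -1) + (if ε 1 then (1 : ℝ) else -1), -(if ε 0 then (1 : ℝ) else -1) + (if ε 2 then (1 : ℝ) else -1),
              -(if ε 1 then (1 : ℝ) else -1) - (if ε 2 then (1 : ℝ) else -1)] k))) 0 := by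
  -- each ray function of the sum is the sum of the ray functions
  have hray : ∀ ε : Fin 3 → Bool,
      iteratedDeriv 3 (fun s : ℝ => (fun z' : Fin 3 → Circle =>
          ((z' 0 : ℂ) * ((z' 2 : ℂ))⁻¹ * ((1 - (z' 1 : ℂ) * ((z' 0 : ℂ))⁻¹) * (1 - (z' 2 : ℂ) * ((z' 1 : ℂ))⁻¹) * (1 - (z' 2 : ℂ) * ((z' 0 : ℂ))⁻¹))) * (∑ i ∈ I, Φ i z'))
          (fun k => x k * Circle.exp (s * ![(if ε 0 then (1 : ℝ) else -1) + (if ε 1 then (1 : ℝ) else -1), -(if ε 0 then (1 : ℝ) else -1) + (if ε 2 then (1 : ℝ) else -1),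
            -(if ε 1 then (1 : ℝ) else -1) - (if ε 2 then (1 : ℝ) else -1)] k))) 0 =
        ∑ i ∈ I, iteratedDeriv 3 (fun s : ℝ => (fun z' : Fin 3 → Circle =>
          ((z' 0 : ℂ) * ((z' 2 : ℂ))⁻¹ * ((1 - (z' 1 : ℂ) * ((z' 0 : ℂ))⁻¹) * (1 - (z' 2 : ℂ) * ((z' 1 : ℂ))⁻¹) * (1 - (z' 2 : ℂ) * ((z' 0 : ℂ))⁻¹))) * Φ i z')
          (fun k => x k * Circle.exp (s * ![(if ε 0 then (1 : ℝ) else -1) + (if ε 1 then (1 : ℝ) else -1), -(if ε 0 then (1 : ℝ) else -1) + (if ε 2 then (1 : ℝ) else -1),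
            -(if ε 1 then (1 : ℝ) else -1) - (if ε 2 then (1 : ℝ) else -1)] k))) 0 := by
    intro ε
    rw [← iteratedDeriv_fun_sum (hΦ · · ε)]
    congr 1
    funext s
    simp only [Finset.mul_sum]
  rw [Finset.sum_congr rfl (fun ε _ => by rw [hray ε])]
  simp only [Finset.mul_sum]
  rw [Finset.sum_comm]

/-- **Termwise limits add up**: if for each `i ∈ I` `Λ_x[Φ_i] → ℓ_i` as `x → x₀` within the regular set, and at every regular `x` the ray functions of the `Φ_i` are `C³` at `0`, then
`Λ_x[Σ_i Φ_i] → Σ_i ℓ_i` (additivity eventually along `𝓝[regular] x₀` + `tendsto_finset_sum`). [cite: Rogawski1990, §8.4 p. 127] -/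
theorem tendsto_lambda8_rhoWeylDelta_finset_sum {ι : Type*} (I : Finset ι) (Φ : ι → (Fin 3 → Circle) → ℂ) (x₀ : Fin 3 → Circle) (ℓ : ι → ℂ)
    (hΦ : ∀ x : Fin 3 → Circle, Function.Injective x → ∀ i ∈ I, ∀ ε : Fin 3 → Bool, ContDiffAt ℝ 3 (fun s : ℝ => (fun z' : Fin 3 → Circle =>
        ((z' 0 : ℂ) * ((z' 2 : ℂ))⁻¹ * ((1 - (z' 1 : ℂ) * ((z' 0 : ℂ))⁻¹) * (1 - (z' 2 : ℂ) * ((z' 1 : ℂ))⁻¹) * (1 - (z' 2 : ℂ) * ((z' 0 : ℂ))⁻¹))) * Φ i z')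
        (fun k => x k * Circle.exp (s * ![(if ε 0 then (1 : ℝ) else -1) + (if ε 1 then (1 : ℝ) else -1), -(if ε 0 then (1 : ℝ) else -1) + (if ε 2 then (1 : ℝ) else -1),
          -(if ε 1 then (1 : ℝ) else -1) - (if ε 2 then (1 : ℝ) else -1)] k))) 0)
    (hlim : ∀ i ∈ I, Tendsto (fun x : Fin 3 → Circle =>
        (1 / 48 : ℂ) * ∑ ε : Fin 3 → Bool, (((if ε 0 then (1 : ℝ) else -1) * (if ε 1 then (1 : ℝ) else -1) * (if ε 2 then (1 : ℝ) else -1) : ℝ) : ℂ) *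
          iteratedDeriv 3 (fun s : ℝ => (fun z' : Fin 3 → Circle =>
              ((z' 0 : ℂ) * ((z' 2 : ℂ))⁻¹ * ((1 - (z' 1 : ℂ) * ((z' 0 : ℂ))⁻¹) * (1 - (z' 2 : ℂ) * ((z' 1 : ℂ))⁻¹) * (1 - (z' 2 : ℂ) * ((z' 0 : ℂ))⁻¹))) * Φ i z')
            (fun k => x k * Circle.exp (s * ![(if ε 0 then (1 : ℝ) else -1) + (if ε 1 then (1 : ℝ) else -1), -(if ε 0 then (1 : ℝ) else -1) + (if ε 2 then (1 : ℝ) else -1),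
              -(if ε 1 then (1 : ℝ) else -1) - (if ε 2 then (1 : ℝ) else -1)] k))) 0)
        (𝓝[{x : Fin 3 → Circle | Function.Injective x}] x₀) (𝓝 (ℓ i))) :
    Tendsto (fun x : Fin 3 → Circle =>
        (1 / 48 : ℂ) * ∑ ε : Fin 3 → Bool, (((if ε 0 then (1 : ℝ) else -1) * (if ε 1 then (1 : ℝ) else -1) * (if ε 2 then (1 : ℝ) else -1) : ℝ) : ℂ) *
          iteratedDeriv 3 (fun s : ℝ => (fun z' : Fin 3 → Circle =>
              ((z' 0 : ℂ) * ((z' 2 : ℂ))⁻¹ * ((1 - (z' 1 : ℂ) * ((z' 0 : ℂ))⁻¹) * (1 - (z' 2 : ℂ) * ((z' 1 : ℂ))⁻¹) * (1 - (z' 2 : ℂ) * ((z' 0 : ℂ))⁻¹))) * (∑ i ∈ I, Φ i z'))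
            (fun k => x k * Circle.exp (s * ![(if ε 0 then (1 : ℝ) else -1) + (if ε 1 then (1 : ℝ) else -1), -(if ε 0 then (1 : ℝ) else -1) + (if ε 2 then (1 : ℝ) else -1),
              -(if ε 1 then (1 : ℝ) else -1) - (if ε 2 then (1 : ℝ) else -1)] k))) 0)
      (𝓝[{x : Fin 3 → Circle | Function.Injective x}] x₀) (𝓝 (∑ i ∈ I, ℓ i)) := by
  have hsum := tendsto_finsetSum I hlim
  refine hsum.congr' ?_
  refine eventually_nhdsWithin_of_forall fun x hx => ?_
  exact (lambda8_rhoWeylDelta_finset_sum I Φ x (hΦ x hx)).symm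

end Engine

end Literature.NumberTheory.Rogawski1990

end
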